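import Literature.Combinatorics.SimpleGraph.RoughIsometry
import Mathlib.Tactic.Linarith
import Mathlib.Tactic.Positivity
import Mathlib.Tactic.Ring
import Mathlib.Tactic.FieldSimp
import HarnessLib

/-!
# Rough isometry is an equivalence relation on connected graphs (Lyons–Peres, Exercise 2.17)

Topic `Literature/Combinatorics/SimpleGraph`.  Lyons–Peres, *Probability on Trees and Networks* (2016), §2.6, Exercise 2.17:
"Show that being roughly isometric is an equivalence relation."  We prove it for CONNECTED graphs (the book's standing setting,
§1.1: distances are lengths of shortest paths), with the definition `IsRoughIsometry` / `RoughlyIsometric` of `RoughIsometry.lean`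
and Mathlib's `SimpleGraph.dist`:

* `isRoughIsometry_id` / `RoughlyIsometric.refl` — the identity is a rough isometry (`α = β = 1`);
* `IsRoughIsometry.comp` / `RoughlyIsometric.trans` — composition (target connected);
* `IsRoughIsometry.exists_inverse` / `RoughlyIsometric.symm` — a quasi-inverse chosen through coboundedness (target graph connected).

## References
* [LyonsPeres2016] R. Lyons, Y. Peres, *Probability on Trees and Networks* (2016), §2.6, (2.20) and Exercise 2.17 (p. 44).
-/

namespace Literature.Combinatorics.SimpleGraph

open _root_.SimpleGraph

variable {V V' V'' : Type*} {G : _root_.SimpleGraph V} {G' : _root_.SimpleGraph V'} {G'' : _root_.SimpleGraph V''}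

/-- The identity map is a rough isometry (`α = β = 1`). [cite: LyonsPeres2016, §2.6 Exercise 2.17 (p. 44)] -/
theorem isRoughIsometry_id (G : _root_.SimpleGraph V) : IsRoughIsometry G G id := by
  refine ⟨1, 1, one_pos, one_pos, fun x y => ⟨?_, ?_⟩, fun x' => ⟨x', ?_⟩⟩
  · simp
  · simp
  · simp

/-- **Reflexivity.** [cite: LyonsPeres2016, §2.6 Exercise 2.17 (p. 44)] -/
theorem RoughlyIsometric.refl (G : _root_.SimpleGraph V) : RoughlyIsometric G G :=
  ⟨id, isRoughIsometry_id G⟩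

/-- **Composition of rough isometries** (the target graph connected, so that its distance satisfies the triangle inequality):
constants `α = α₁α₂`, `β = α₂ β₁ + α₂⁻¹ β₁ + 3 β₂`. [cite: LyonsPeres2016, §2.6 Exercise 2.17 (p. 44)] -/
theorem IsRoughIsometry.comp {φ : V → V'} {ψ : V' → V''} (hG'' : G''.Connected) (hφ : IsRoughIsometry G G' φ)
    (hψ : IsRoughIsometry G' G'' ψ) : IsRoughIsometry G G'' (ψ ∘ φ) := by
  obtain ⟨α₁, β₁, hα₁, hβ₁, h₁, c₁⟩ := hφ
  obtain ⟨α₂, β₂, hα₂, hβ₂, h₂, c₂⟩ := hψ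
  refine ⟨α₁ * α₂, α₂ * β₁ + α₂⁻¹ * β₁ + 3 * β₂, by positivity, by positivity, fun x y => ⟨?_, ?_⟩, fun x'' => ?_⟩
  · -- lower bound
    obtain ⟨l₁, -⟩ := h₁ x y
    obtain ⟨l₂, -⟩ := h₂ (φ x) (φ y)
    have hd : (0 : ℝ) ≤ (G.dist x y : ℝ) := Nat.cast_nonneg _
    have e : (α₁ * α₂)⁻¹ * (G.dist x y : ℝ) = α₂⁻¹ * (α₁⁻¹ * (G.dist x y : ℝ)) := by
      rw [mul_inv]; ring
    have step : α₂⁻¹ * (α₁⁻¹ * (G.dist x y : ℝ)) - α₂⁻¹ * β₁ ≤ α₂⁻¹ * (G'.dist (φ x) (φ y) : ℝ) := by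
      have := mul_le_mul_of_nonneg_left l₁ (inv_pos.2 hα₂).le
      linarith [this, show α₂⁻¹ * (α₁⁻¹ * (G.dist x y : ℝ) - β₁) = α₂⁻¹ * (α₁⁻¹ * (G.dist x y : ℝ)) - α₂⁻¹ * β₁ by ring]
    show (α₁ * α₂)⁻¹ * (G.dist x y : ℝ) - (α₂ * β₁ + α₂⁻¹ * β₁ + 3 * β₂) ≤ (G''.dist (ψ (φ x)) (ψ (φ y)) : ℝ)
    rw [e]
    have hnn : 0 ≤ α₂ * β₁ := by positivity
    linarith
  · -- upper bound
    obtain ⟨-, u₁⟩ := h₁ x y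
    obtain ⟨-, u₂⟩ := h₂ (φ x) (φ y)
    show (G''.dist (ψ (φ x)) (ψ (φ y)) : ℝ) ≤ α₁ * α₂ * (G.dist x y : ℝ) + (α₂ * β₁ + α₂⁻¹ * β₁ + 3 * β₂)
    have := mul_le_mul_of_nonneg_left u₁ hα₂.le
    have hnn : 0 ≤ α₂⁻¹ * β₁ := by positivity
    nlinarith
  · -- coboundedness (triangle inequality in `G''`)
    obtain ⟨x', hx'⟩ := c₂ x''
    obtain ⟨x, hx⟩ := c₁ x'
    refine ⟨x, ?_⟩
    obtain ⟨-, u₂⟩ := h₂ x' (φ x)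
    have tri : (G''.dist x'' (ψ (φ x)) : ℝ) ≤ (G''.dist x'' (ψ x') : ℝ) + (G''.dist (ψ x') (ψ (φ x)) : ℝ) := by
      exact_mod_cast hG''.dist_triangle (u := x'') (v := ψ x') (w := ψ (φ x))
    show (G''.dist x'' ((ψ ∘ φ) x) : ℝ) ≤ α₂ * β₁ + α₂⁻¹ * β₁ + 3 * β₂
    have := mul_le_mul_of_nonneg_left hx hα₂.le
    have hnn : 0 ≤ α₂⁻¹ * β₁ := by positivity
    simp only [Function.comp_apply]
    linarith

/-- **Transitivity** (third graph connected). [cite: LyonsPeres2016, §2.6 Exercise 2.17 (p. 44)] -/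
theorem RoughlyIsometric.trans (hG'' : G''.Connected) (h₁ : RoughlyIsometric G G') (h₂ : RoughlyIsometric G' G'') :
    RoughlyIsometric G G'' := by
  obtain ⟨φ, hφ⟩ := h₁
  obtain ⟨ψ, hψ⟩ := h₂
  exact ⟨ψ ∘ φ, hφ.comp hG'' hψ⟩

/-- **Quasi-inverse**: a rough isometry into a connected graph has a rough isometry going back — send `x'` to any `x` with
`dist'(x', φ x) ≤ β` (coboundedness; only the target's triangle inequality is used). [cite: LyonsPeres2016, §2.6 Exercise 2.17 (p. 44)] -/
theorem IsRoughIsometry.exists_inverse {φ : V → V'} (hG' : G'.Connected) (hφ : IsRoughIsometry G G' φ) :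
    ∃ ψ : V' → V, IsRoughIsometry G' G ψ := by
  obtain ⟨α, β, hα, hβ, h, c⟩ := hφ
  choose ψ hψ using c
  refine ⟨ψ, α, 3 * α * β + 3 * α⁻¹ * β + β, hα, by positivity, fun x' y' => ⟨?_, ?_⟩, fun x => ⟨φ x, ?_⟩⟩
  · -- lower: α⁻¹ dist'(x',y') - β' ≤ dist(ψ x', ψ y')
    obtain ⟨-, u⟩ := h (ψ x') (ψ y')
    have t1 : (G'.dist x' y' : ℝ) ≤ (G'.dist x' (φ (ψ x')) : ℝ) + (G'.dist (φ (ψ x')) y' : ℝ) := by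
      exact_mod_cast hG'.dist_triangle (u := x') (v := φ (ψ x')) (w := y')
    have t2 : (G'.dist (φ (ψ x')) y' : ℝ) ≤ (G'.dist (φ (ψ x')) (φ (ψ y')) : ℝ) + (G'.dist (φ (ψ y')) y' : ℝ) := by
      exact_mod_cast hG'.dist_triangle (u := φ (ψ x')) (v := φ (ψ y')) (w := y')
    have s1 := hψ x'
    have s2 : (G'.dist (φ (ψ y')) y' : ℝ) ≤ β := by rw [SimpleGraph.dist_comm]; exact hψ y'
    -- dist'(x',y') ≤ α dist(ψx',ψy') + 3β, divide by α
    have key : (G'.dist x' y' : ℝ) ≤ α * (G.dist (ψ x') (ψ y') : ℝ) + 3 * β := by linarith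
    have := mul_le_mul_of_nonneg_left key (inv_pos.2 hα).le
    rw [mul_add, ← mul_assoc, inv_mul_cancel₀ hα.ne', one_mul] at this
    have hnn : 0 ≤ 3 * α * β := by positivity
    linarith
  · -- upper: dist(ψ x', ψ y') ≤ α dist'(x',y') + β'
    obtain ⟨l, -⟩ := h (ψ x') (ψ y')
    have t1 : (G'.dist (φ (ψ x')) (φ (ψ y')) : ℝ) ≤ (G'.dist (φ (ψ x')) x' : ℝ) + (G'.dist x' (φ (ψ y')) : ℝ) := by
      exact_mod_cast hG'.dist_triangle (u := φ (ψ x')) (v := x') (w := φ (ψ y'))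
    have t2 : (G'.dist x' (φ (ψ y')) : ℝ) ≤ (G'.dist x' y' : ℝ) + (G'.dist y' (φ (ψ y')) : ℝ) := by
      exact_mod_cast hG'.dist_triangle (u := x') (v := y') (w := φ (ψ y'))
    have s1 : (G'.dist (φ (ψ x')) x' : ℝ) ≤ β := by rw [SimpleGraph.dist_comm]; exact hψ x'
    have s2 := hψ y'
    -- α⁻¹ dist(ψx',ψy') ≤ dist' + 3β  ⇒ dist ≤ α dist' + 3αβ
    have key : α⁻¹ * (G.dist (ψ x') (ψ y') : ℝ) ≤ (G'.dist x' y' : ℝ) + 3 * β := by linarith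
    have := mul_le_mul_of_nonneg_left key hα.le
    rw [mul_add, ← mul_assoc, mul_inv_cancel₀ hα.ne', one_mul] at this
    have hnn : 0 ≤ 3 * α⁻¹ * β := by positivity
    linarith
  · -- coboundedness: dist(x, ψ (φ x)) ≤ β'
    obtain ⟨l, -⟩ := h x (ψ (φ x))
    have s : (G'.dist (φ x) (φ (ψ (φ x))) : ℝ) ≤ β := hψ (φ x)
    have key : α⁻¹ * (G.dist x (ψ (φ x)) : ℝ) ≤ 2 * β := by linarith
    have := mul_le_mul_of_nonneg_left key hα.le
    rw [← mul_assoc, mul_inv_cancel₀ hα.ne', one_mul] at this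
    have hnn : 0 ≤ 3 * α⁻¹ * β := by positivity
    have hnn' : 0 ≤ α * β := by positivity
    linarith

/-- **Symmetry** (the second graph connected). [cite: LyonsPeres2016, §2.6 Exercise 2.17 (p. 44)] -/
theorem RoughlyIsometric.symm (hG' : G'.Connected) (h : RoughlyIsometric G G') :
    RoughlyIsometric G' G := by
  obtain ⟨φ, hφ⟩ := h
  exact hφ.exists_inverse hG'

end Literature.Combinatorics.SimpleGraph
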